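import Summits.BirchSwinnertonDyer.BirchSwinnertonDyer.Theorems.PrintCFramBottomClassIndexLawFiveLeTransferAnatomy
import Summits.BirchSwinnertonDyer.Rank1Residual.X12.CMIsogenyInvariance
import Summits.BirchSwinnertonDyer.Rank1Residual.X12.CMInertTrace
import Summits.BirchSwinnertonDyer.Rank1Residual.X12.CMIrreducible
import Summits.BirchSwinnertonDyer.Rank1Residual.X12.CMNoPrimeTorsion
import Literature.NumberTheory.EllipticCurves.ComplexMultiplicationTwistIsogenyCertProofs
import Literature.NumberTheory.EllipticCurves.ComplexMultiplicationMaximalOrderLeavesProofs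
import Literature.NumberTheory.EllipticCurves.IsogenyQuadraticTwistProofs
import Literature.NumberTheory.EllipticCurves.IsogenyDualProofs
import Summits.BirchSwinnertonDyer.BirchSwinnertonDyer.Theorems.Rank1ResidualX1Isogeny
import Literature.NumberTheory.EllipticCurves.ComplexMultiplicationShaKnappProofs
import Literature.NumberTheory.EllipticCurves.CyclotomicIwasawaMainTheoremIrreducibleBaseChangeProofs
import HarnessLib

set_option linter.dupNamespace false

/-!
# Route `PrintCFram`, crux S3 `BottomClassIndexLawFiveLe` (item stmt-BirchSwinnertonDyer-20372), line
# `relative-anchor-transfer`: THE TRANSFER STUB REDUCES TO TWISTING PARAMETERS COPRIME TO `p`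
# (lead seat `bsd-line-cfram-p1`; THEOREMS ONLY — nothing asserted about any curve, no stub closed, BSD not
# proved by any of this)

The idea card's cheapest-falsifier clause (c) and the critic's price (P3) say: «a twist by `D` with `p ∣ D` must
first be replaced by its isogenous `W^{(−D/p)}` — if the period is not `D`-independent there, the transfer
statement needs the isogeny bookkeeping made explicit». This file makes that bookkeeping explicit and
kernel-checked, at the level where the tree reads the transfer stub (`BSD_p`, file
`PrintCFramBottomClassIndexLawFiveLeTransferAnatomy`):

* §1 `isIsogenous_quadraticTwist_cmFieldDiscrOfJ` — EVERY CM curve `W/ℚ` (any of the thirteen `j`) is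
  `ℚ`-isogenous to its twist by the CM-field discriminant `d_K = cmFieldDiscrOfJ (j W)` (Milne 1972 /
  Burungale–Flach for maximal orders, discharged in the tree, transported along an isogeny to a maximal-order
  curve); at a CM-ramified `p ≥ 5`, `d_K = −p`.
* §2 `exists_coprime_twist_isIsogenous` — THE CLASS MODULO ISOGENY: if `W₀` is CM with `p ≥ 5` CM-ramified and
  `j W = j W₀`, then `W` is `ℚ`-isogenous to a globally minimal model of `W₀^{(e)}` for a squarefree integer `e`
  with `p ∤ e` (write `C • W = W₀^{(d)}`, `d` squarefree; if `p ∣ d`, `d = p e'` and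
  `W₀^{(d)} = (W₀^{(−p)})^{(−e')} ∼ W₀^{(−e')}`).
* §3 `bsdp_transfer_iff_coprime` — for fixed `(W₀, p)`: «`BSD(W₀, p) → BSD(W, p)` for every globally minimal `W`
  of analytic rank one with `j W = j W₀`» ⟺ «the same for the globally minimal models of the twists `W₀^{(e)}`,
  `e` squarefree, `p ∤ e`», granted GZK, modularity, Cassels (isogeny invariance of `BSD(·, p)` at analytic rank
  `≤ 1`, `Rank1ResidualX1Isogeny.bsdp_iff_of_isIsogenous`). With the anatomy file
  (`stubRelativeTransfer_iff_bsdp_transfer`) the registered `stub_relativeTransfer` is therefore, modulo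
  (R-IMC)∃-Zp and the four refereed facts, a statement about twisting parameters COPRIME to `p` only — exactly
  the `(D, 7) = 1` bookkeeping regime of cell `bsd-cm`'s 𝒞₇ mechanism (`stubRelativeTransfer_of_coprime_bsdp_transfer`).

beyond-print theorem: NO. Supports, does not close, stmt-BirchSwinnertonDyer-20372.

References: [SilvermanAEC2009] X.5 Prop. 5.4, Cor. 5.4.1, VIII.8 Cor. 8.3; [CremonaAlgorithms1997] §3.9;
[BurungaleFlach2024] proof of Cor. 2; [Milne1972ArithmeticAV] Thm. 3; [Miller2011LMS] Def. 1.1;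
[Cassels1965ArithmeticVIII].
-/

noncomputable section

open scoped Classical

open WeierstrassCurve Literature.NumberTheory.EllipticCurves Literature.NumberTheory.EllipticCurves.Rank1Residual
  Summit.BirchSwinnertonDyer.Rank1Residual Summit.BirchSwinnertonDyer.Rank1Residual.X12
  Summit.BirchSwinnertonDyer.Rank1Residual.X12.O11
  Summit.BirchSwinnertonDyer.BirchSwinnertonDyer.Theorems.RamifiedSevenEllipticUnits

namespace Summit.BirchSwinnertonDyer.BirchSwinnertonDyer.Theorems.PrintCFram.RelativeAnchorTransfer

/-! ### §1. Every CM curve over `ℚ` is isogenous to its twist by the CM discriminant -/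

/-- **`W ∼ W^{(d_K)}` for every CM curve `W/ℚ`**, `d_K = cmFieldDiscrOfJ (j W)` the discriminant of the CM
field: `W ∼ W₀` with `j W₀` of maximal order (Silverman AT Ex. 2.12(b), discharged), `d_K(W₀) = d_K(W)`
(isogeny invariance), `W₀ ∼ W₀^{(d_K)}` (Milne 1972 Thm. 3 / Burungale–Flach Cor. 2, discharged as
`isIsogenous_quadraticTwist_cmFieldDiscr_holds`), and twisting the isogeny `W ∼ W₀` by `d_K` (Cremona §3.9).
The argument of cell `bsd-cm`'s `isIsogenous_of_isFrame`, stated curve-intrinsically.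
[cite: BurungaleFlach2024, proof of Cor. 2 (arXiv p. 4)] [cite: CremonaAlgorithms1997, §3.9 (p. 87)] -/
theorem isIsogenous_quadraticTwist_cmFieldDiscrOfJ (W : WeierstrassCurve ℚ) [W.IsElliptic] (hCM : W.HasCM) :
    IsIsogenous W (W.quadraticTwist ((cmFieldDiscrOfJ W.j : ℤ) : ℚ)) := by
  set d : ℤ := cmFieldDiscrOfJ W.j with hd
  have hd0 : (d : ℚ) ≠ 0 := by exact_mod_cast X12.cmFieldDiscrOfJ_ne_zero_of_hasCM W hCM
  haveI := W.isElliptic_quadraticTwist hd0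
  obtain ⟨W₀, _, hiso₀, hj₀⟩ := exists_isIsogenous_j_mem_maximalCMJInvariants_of_hasCM_holds W hCM
  have hdisc : cmFieldDiscr W₀.j = d := by
    rw [X12.cmFieldDiscr_eq_cmFieldDiscrOfJ hj₀, hd, X12.cmFieldDiscrOfJ_eq_of_isIsogenous hiso₀ hCM]
  haveI := W₀.isElliptic_quadraticTwist hd0
  have h1 : IsIsogenous W₀ (W₀.quadraticTwist (d : ℚ)) := by
    have := isIsogenous_quadraticTwist_cmFieldDiscr_holds W₀ hj₀
    rwa [hdisc] at this
  have h2 : IsIsogenous (W.quadraticTwist (d : ℚ)) (W₀.quadraticTwist (d : ℚ)) := hiso₀.quadraticTwist hd0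
  exact (hiso₀.trans' h1).trans' h2.symm_of_charZero

/-- **At a CM-ramified `p ≥ 5`: `W ∼ W^{(−p)}`** (`d_K = −p`, `X12.cmFieldDiscrOfJ_eq_neg_of_dvd`).
[cite: BurungaleFlach2024, proof of Cor. 2 (arXiv p. 4)] [cite: CremonaAlgorithms1997, §3.9 (p. 87)] -/
theorem isIsogenous_quadraticTwist_neg_prime (W : WeierstrassCurve ℚ) [W.IsElliptic] {p : ℕ} [Fact p.Prime]
    (hCM : W.HasCM) (hram : CMRamified W p) (h5 : 5 ≤ p) :
    IsIsogenous W (W.quadraticTwist (-(p : ℚ))) := by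
  have hd : cmFieldDiscrOfJ W.j = -(p : ℤ) := X12.cmFieldDiscrOfJ_eq_neg_of_dvd W hCM Fact.out h5 hram
  have := isIsogenous_quadraticTwist_cmFieldDiscrOfJ W hCM
  rwa [hd, Int.cast_neg, Int.cast_natCast] at this

/-! ### §2. The class modulo isogeny: twisting parameters coprime to `p` suffice -/

/-- `j ≠ 0` for a CM curve with a CM-ramified prime `p ≥ 5` (`d_K(j = 0) = −3`). [folklore] -/
theorem j_ne_zero_of_cmRamified_five_le (W : WeierstrassCurve ℚ) [W.IsElliptic] {p : ℕ} [Fact p.Prime]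
    (hCM : W.HasCM) (hram : CMRamified W p) (h5 : 5 ≤ p) : W.j ≠ 0 := by
  intro hj
  have hd : cmFieldDiscrOfJ W.j = -(p : ℤ) := X12.cmFieldDiscrOfJ_eq_neg_of_dvd W hCM Fact.out h5 hram
  rw [hj] at hd
  norm_num [cmFieldDiscrOfJ] at hd
  omega

/-- `j ≠ 1728` for a CM curve with a CM-ramified prime `p ≥ 5` (`d_K(j = 1728) = −4`). [folklore] -/
theorem j_ne_1728_of_cmRamified_five_le (W : WeierstrassCurve ℚ) [W.IsElliptic] {p : ℕ} [Fact p.Prime]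
    (hCM : W.HasCM) (hram : CMRamified W p) (h5 : 5 ≤ p) : W.j ≠ 1728 := by
  intro hj
  have hd : cmFieldDiscrOfJ W.j = -(p : ℤ) := X12.cmFieldDiscrOfJ_eq_neg_of_dvd W hCM Fact.out h5 hram
  rw [hj] at hd
  norm_num [cmFieldDiscrOfJ] at hd
  omega

/-- **THE CLASS MODULO ISOGENY.** Let `W₀/ℚ` be CM with `p ≥ 5` CM-ramified and let `W/ℚ` have `j W = j W₀`.
Then there are a squarefree integer `e ≠ 0` with `p ∤ e`, a globally minimal model `W₁` of the twist
`W₀^{(e)}` (`C • W₁ = W₀^{(e)}`) and a `ℚ`-isogeny `W ∼ W₁`. Proof: `C' • W = W₀^{(d)}` with `d` squarefree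
(Silverman X.5.4, `exists_variableChange_eq_quadraticTwist_intCast_of_j_eq`; `j ≠ 0, 1728` by §2's lemmas); if
`p ∤ d` take `e = d`; if `d = p e'` take `e = −e'`: `W₀^{(d)} = (W₀^{(−p)})^{(−e')}` (`quadraticTwist_quadraticTwist`)
and `W₀^{(−e')} ∼ (W₀^{(−p)})^{(−e')}` by twisting `W₀ ∼ W₀^{(−p)}` (§1). Globally minimal models by Silverman
VIII.8.3. [cite: SilvermanAEC2009, X.5 Prop. 5.4, Cor. 5.4.1 and VIII.8 Cor. 8.3] [cite: CremonaAlgorithms1997, §3.9 (p. 87)] -/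
theorem exists_coprime_twist_isIsogenous {W₀ W : WeierstrassCurve ℚ} [W₀.IsElliptic] [W.IsElliptic] {p : ℕ}
    [Fact p.Prime] (hCM₀ : W₀.HasCM) (hram₀ : CMRamified W₀ p) (h5 : 5 ≤ p) (hj : W.j = W₀.j) :
    ∃ e : ℤ, e ≠ 0 ∧ Squarefree e ∧ ¬ (p : ℤ) ∣ e ∧
      ∃ (W₁ : WeierstrassCurve ℚ) (_ : W₁.IsElliptic) (_ : W₁.IsGloballyMinimal) (C : VariableChange ℚ),
        C • W₁ = W₀.quadraticTwist (e : ℚ) ∧ IsIsogenous W W₁ := by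
  have hp : p.Prime := Fact.out
  obtain ⟨d, hd0, hdsq, C', hC'⟩ := exists_variableChange_eq_quadraticTwist_intCast_of_j_eq hj
    (j_ne_zero_of_cmRamified_five_le W₀ hCM₀ hram₀ h5) (j_ne_1728_of_cmRamified_five_le W₀ hCM₀ hram₀ h5)
  by_cases hpd : (p : ℤ) ∣ d
  · -- `d = p e'`, `e = -e'`
    obtain ⟨e', rfl⟩ := hpd
    have he'0 : e' ≠ 0 := by rintro rfl; simp at hd0
    have hpe' : ¬ (p : ℤ) ∣ e' := by
      rintro ⟨f, rfl⟩
      have hu : IsUnit (p : ℤ) := hdsq p ⟨f, by ring⟩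
      rcases Int.isUnit_iff.mp hu with h | h <;> omega
    refine ⟨-e', neg_ne_zero.mpr he'0, (hdsq.of_mul_right).squarefree_of_dvd (neg_dvd.mpr dvd_rfl),
      fun h ↦ hpe' (dvd_neg.mp h), ?_⟩
    have he0 : ((-e' : ℤ) : ℚ) ≠ 0 := by exact_mod_cast neg_ne_zero.mpr he'0
    obtain ⟨W₁, hW₁E, hW₁M, C₁, hC₁⟩ := exists_isGloballyMinimal_smul_eq_quadraticTwist W₀ he0
    refine ⟨W₁, hW₁E, hW₁M, C₁, hC₁, ?_⟩
    have hp0 : (-(p : ℚ)) ≠ 0 := neg_ne_zero.mpr (Nat.cast_ne_zero.mpr hp.ne_zero)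
    haveI := W₀.isElliptic_quadraticTwist hp0
    haveI := W₀.isElliptic_quadraticTwist he0
    haveI : (W₀.quadraticTwist (((p : ℤ) * e' : ℤ) : ℚ)).IsElliptic :=
      W₀.isElliptic_quadraticTwist (by exact_mod_cast hd0)
    -- `W₀^{(-e')} ∼ (W₀^{(-p)})^{(-e')} = W₀^{(p e')}`
    have htw : (W₀.quadraticTwist (-(p : ℚ))).quadraticTwist ((-e' : ℤ) : ℚ) =
        W₀.quadraticTwist (((p : ℤ) * e' : ℤ) : ℚ) := by
      rw [quadraticTwist_quadraticTwist]; push_cast; ring_nf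
    have h1 : IsIsogenous (W₀.quadraticTwist ((-e' : ℤ) : ℚ)) (W₀.quadraticTwist (((p : ℤ) * e' : ℤ) : ℚ)) := by
      have h := (isIsogenous_quadraticTwist_neg_prime W₀ hCM₀ hram₀ h5).quadraticTwist he0
      rwa [htw] at h
    -- `W ∼ C' • W = W₀^{(d)} ∼ W₀^{(-e')} = C₁ • W₁ ∼ W₁`
    have h2 : IsIsogenous W (W₀.quadraticTwist (((p : ℤ) * e' : ℤ) : ℚ)) := hC' ▸ isIsogenous_smul W C'
    have h3 : IsIsogenous W (W₀.quadraticTwist ((-e' : ℤ) : ℚ)) := h2.trans' h1.symm_of_charZero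
    rw [← hC₁] at h3
    exact h3.trans' (isIsogenous_of_smul _ _)
  · refine ⟨d, hd0, hdsq, hpd, ?_⟩
    have hd0' : ((d : ℤ) : ℚ) ≠ 0 := by exact_mod_cast hd0
    obtain ⟨W₁, hW₁E, hW₁M, C₁, hC₁⟩ := exists_isGloballyMinimal_smul_eq_quadraticTwist W₀ hd0'
    refine ⟨W₁, hW₁E, hW₁M, C₁, hC₁, ?_⟩
    have h2 : IsIsogenous W (W₀.quadraticTwist (d : ℚ)) := hC' ▸ isIsogenous_smul W C'
    rw [← hC₁] at h2
    exact h2.trans' (isIsogenous_of_smul _ _)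

/-! ### §3. The transfer at fixed `(W₀, p)` reduces to coprime twisting parameters -/

section Transfer

variable {W₀ : WeierstrassCurve ℚ} [W₀.IsElliptic] {p : ℕ} [Fact p.Prime]

/-- **`BSD_p`-TRANSFER FROM `W₀` REDUCES TO COPRIME TWISTS**, granted GZK, modularity, Cassels. For `W₀` CM with
`p ≥ 5` CM-ramified: «`BSD(W₀, p) → BSD(W, p)` for every globally minimal `W` of analytic rank one with
`j W₀ = j W`» iff «`BSD(W₀, p) → BSD(W₁, p)` for every globally minimal model `W₁` of analytic rank one of a twist
`W₀^{(e)}` with `e` squarefree and `p ∤ e`». (→) such a `W₁` has `j W₁ = j W₀`; (←) §2 and the isogeny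
invariance of the analytic rank (Knapp 11.67) and of `BSD(·, p)` at analytic rank `≤ 1`
(`Rank1ResidualX1Isogeny.bsdp_iff_of_isIsogenous`). [cite: Miller2011LMS, Def. 1.1 (arXiv:1010.2431 p. 3)]
[cite: SilvermanAEC2009, X.5 Prop. 5.4 and Cor. 5.4.1] [cite: Cassels1965ArithmeticVIII] -/
theorem bsdp_transfer_iff_coprime (hGZK : rank_eq_analyticRank_of_analyticRank_le_one)
    (hmod : hasEntireLFunction_rat) (hCassels : bsdRHS_eq_of_isIsogenous) (hCM₀ : W₀.HasCM)
    (hram₀ : CMRamified W₀ p) (h5 : 5 ≤ p) :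
    (∀ (W : WeierstrassCurve ℚ) [W.IsElliptic] [W.IsGloballyMinimal],
        W.analyticRank = 1 → W₀.j = W.j → BSDp W₀ p → BSDp W p) ↔
    (∀ (e : ℤ), Squarefree e → ¬ (p : ℤ) ∣ e →
      ∀ (W₁ : WeierstrassCurve ℚ) [W₁.IsElliptic] [W₁.IsGloballyMinimal] (C : VariableChange ℚ),
        C • W₁ = W₀.quadraticTwist (e : ℚ) → W₁.analyticRank = 1 → BSDp W₀ p → BSDp W₁ p) := by
  constructor
  · intro h e hsq _ W₁ _ _ C hC hr₁
    have he0 : (e : ℚ) ≠ 0 := by exact_mod_cast hsq.ne_zero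
    haveI := W₀.isElliptic_quadraticTwist he0
    have key : ∀ (V : WeierstrassCurve ℚ) [V.IsElliptic], V = W₀.quadraticTwist (e : ℚ) → V.j = W₀.j := by
      rintro V _ rfl
      exact W₀.j_quadraticTwist he0
    have hj : W₀.j = W₁.j := (key (C • W₁) hC).symm.trans (W₁.variableChange_j C)
    exact h W₁ hr₁ hj
  · intro h W _ _ hr hj hB₀
    obtain ⟨e, -, hsq, hpe, W₁, _, _, C, hC, hiso⟩ := exists_coprime_twist_isIsogenous hCM₀ hram₀ h5 hj.symm
    have hr₁ : W₁.analyticRank = 1 := by rw [← analyticRank_eq_of_isIsogenous' hiso]; exact hr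
    have hB₁ : BSDp W₁ p := h e hsq hpe W₁ C hC hr₁ hB₀
    exact (Rank1ResidualX1Isogeny.bsdp_iff_of_isIsogenous hGZK hmod hCassels W W₁ hiso p hr.le).2 hB₁

/-- **The registered `stub_relativeTransfer` (verbatim) ⟸ the COPRIME `BSD_p`-transfer**, granted (R-IMC)∃-Zp on
the leaf and {modularity, GZ I.(7.3), GZK, Cassels}: it suffices to move `BSD(·, p)` from each anchor candidate
`W₀` (CM, `p ≥ 5` CM-ramified, analytic rank one) to the globally minimal models of analytic rank one of its
twists `W₀^{(e)}` by squarefree `e` COPRIME to `p`. The members with `p ∣ D` cost nothing (§2: they are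
isogenous to coprime twists, and `BSD(·, p)` is an isogeny invariant). [cite: Miller2011LMS, Def. 1.1 (arXiv:1010.2431 p. 3)]
[cite: SilvermanAEC2009, X.5 Prop. 5.4 and Cor. 5.4.1] [cite: Cassels1965ArithmeticVIII] -/
theorem stubRelativeTransfer_of_coprime_bsdp_transfer (hmod : hasEntireLFunction_rat)
    (hGZ : GrossZagier1986_thm_I_7_3) (hGZK : rank_eq_analyticRank_of_analyticRank_le_one)
    (hCassels : bsdRHS_eq_of_isIsogenous)
    (hIMC : ∀ (W : WeierstrassCurve ℚ) [W.IsElliptic] [W.IsGloballyMinimal] (p : ℕ) [Fact p.Prime],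
      5 ≤ p → W.HasCM → W.analyticRank = 1 → CMRamified W p → RamifiedCMEllipticUnitIMCAtZp W p)
    (hcop : ∀ (W₀ : WeierstrassCurve ℚ) [W₀.IsElliptic] [W₀.IsGloballyMinimal] (p : ℕ) [Fact p.Prime],
      W₀.HasCM → CMRamified W₀ p → 5 ≤ p → W₀.analyticRank = 1 →
      ∀ (e : ℤ), Squarefree e → ¬ (p : ℤ) ∣ e →
        ∀ (W₁ : WeierstrassCurve ℚ) [W₁.IsElliptic] [W₁.IsGloballyMinimal] (C : VariableChange ℚ),
          C • W₁ = W₀.quadraticTwist (e : ℚ) → W₁.analyticRank = 1 → BSDp W₀ p → BSDp W₁ p) :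
    ∀ (W : WeierstrassCurve ℚ) [W.IsElliptic] [W.IsGloballyMinimal] (W₀ : WeierstrassCurve ℚ) [W₀.IsElliptic]
      [W₀.IsGloballyMinimal] (p : ℕ) [Fact p.Prime],
      W.HasCM → CMRamified W p → 5 ≤ p → W.analyticRank = 1 →
      W₀.HasCM → CMRamified W₀ p → W₀.analyticRank = 1 → W₀.j = W.j →
      RamifiedCMRubinFormulaAtZp W₀ p → RamifiedCMRubinFormulaAtZp W p := by
  refine (stubRelativeTransfer_iff_bsdp_transfer hmod hGZ hGZK hCassels hIMC).2 ?_
  intro W _ _ W₀ _ _ p _ _ _ h5 hr hCM₀ hram₀ hr₀ hj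
  exact (bsdp_transfer_iff_coprime hGZK hmod hCassels hCM₀ hram₀ h5).2 (hcop W₀ p hCM₀ hram₀ h5 hr₀) W hr hj

end Transfer

end Summit.BirchSwinnertonDyer.BirchSwinnertonDyer.Theorems.PrintCFram.RelativeAnchorTransfer

end
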